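import Literature.Combinatorics.LorentzianPolynomials.Bivariate
import Literature.LinearAlgebra.QuadraticForm.LorentzianReverseSchwarz
import HarnessLib

/-!
# Lorentzian quadratic forms: M-convexity of the support is automatic; Theorem 2.25 as printed
# (Brändén–Huh 2020, Lemma 2.5 and Theorem 2.25)

Layer `Literature/Combinatorics/LorentzianPolynomials`, namespace `Literature.Combinatorics.LorentzianPolynomials`;
lane `lit-hodgefound` (Track 2 foundations library), seat p16, generation 27 (row g27-#7). Sequel of `Basic.lean` (row g27-#1:
`lorentzian σ d` = `L^d_n` by Definition 2.6, with `L²_n` read — through Theorem 2.25 at `d = 2` — as "nonnegative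
coefficients, M-convex support, Hessian with at most one positive eigenvalue (`sigPos ≤ 1`)"; the second form of Def. 2.6
`mem_lorentzian_iff_forall_iterPderiv`) and `Bivariate.lean` (row g27-#6: `coeff_iterPderiv_nonneg`); uses the tree's
reverse Cauchy–Schwarz inequality `LinearAlgebra/QuadraticForm/LorentzianReverseSchwarz.mul_le_sq_of_sigPos_le_one`
(Shenfeld–van Handel Lemma 2.9).

## Source (verbatim) — P. Brändén, J. Huh, *Lorentzian polynomials* [BrandenHuh2019] (held `paper:arxiv-1902.03719`)

* §2.1 **Lemma 2.5**: "The following conditions are equivalent for any `f ∈ P²_n`. (1) The Hessian of `f` has the Lorentzian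
  signature `(+, -, …, -)` […] (2) For any nonzero `u ∈ ℝ^n_{≥0}`, `(u^T 𝓗_f v)² > (u^T 𝓗_f u)(v^T 𝓗_f v)` for any `v ∈ ℝ^n`
  not parallel to `u`. […] It follows that a quadratic form with nonnegative coefficients is strictly Lorentzian if and only
  if it is strictly stable. Thus, a quadratic form with nonnegative coefficients is Lorentzian if and only if it is stable."
  Proof of (1) ⇒ (2): "Since all the entries of `𝓗_f` are positive, `u^T 𝓗_f u > 0` for any nonzero `u ∈ ℝ^n_{≥0}`. By Cauchy's
  interlacing theorem, for any `v ∈ ℝ^n` not parallel to `u`, the restriction of `𝓗_f` to the plane spanned by `u, v` has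
  signature `(+, -)`."
* §2.4 **Theorem 2.25**: "a degree `d` homogeneous polynomial `f` with nonnegative coefficients is Lorentzian if and only if
  the support of `f` is M-convex and `∂^α f` has at most one positive eigenvalue for every `α ∈ Δ^{d-2}_n`."
* §2.2 (p. 11): the exchange property defining M-convex sets; Definition 2.6.
* Y. Shenfeld, R. van Handel [ShenfeldVanHandel2019], Lemma 2.9: "The positive eigenspace of `A` has dimension at most one"
  ⇔ "`⟨x,Ay⟩² ≥ ⟨x,Ax⟩⟨y,Ay⟩` for all `x, y` such that `⟨y,Ay⟩ ≥ 0`" (tree: `mul_le_sq_of_sigPos_le_one`).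

## What is proved

For a quadratic form `q` with nonnegative coefficients and Hessian `𝓗 = 𝓗_q` (`𝓗_{ij} = c_{e_i+e_j}`, nonnegative) with at
most one positive eigenvalue:
* §1 `exists_eq_single_add_single_of_degree_eq_two` (`Δ²_n = {e_i + e_j}`), `hessian_nonneg`, `hessian_pos_iff`
  (`coeff_{e_i+e_j} q ≠ 0 ⟺ 𝓗_{ij} > 0`).
* §2 the engine **`toBilin'_hessian_single_ne_zero`**: if `𝓗_{im} > 0` and `y^T 𝓗 y > 0` then `(𝓗 y)_m ≠ 0` — the reverse
  Cauchy–Schwarz inequality `(x^T 𝓗 y)² ≥ (x^T 𝓗 x)(y^T 𝓗 y)` at `x = e_m + t e_i` reads `t² ((𝓗y)_i)² ≥ (𝓗_{mm} + 2t𝓗_{im} +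
  t²𝓗_{ii}) · y^T𝓗y ≥ 2t 𝓗_{im} · y^T 𝓗 y`, impossible for small `t > 0` (Lemma 2.5 (1) ⇒ (2) in the form used here);
  `hessian_pos_or_pos` (`𝓗_{kl} > 0 ⟹ 𝓗_{mk} > 0 ∨ 𝓗_{ml} > 0` whenever `𝓗_{im} > 0` for some `i`).
* §3 **`isMConvex_support_of_sigPos_le_one`**: the support of such a `q` is M-convex (the exchange property, case by case,
  the engine supplying the exchange partner), hence **`mem_lorentzian_two_iff_sigPos`**: `L²_n` is exactly the set of
  quadratic forms with nonnegative coefficients whose Hessian has at most one positive eigenvalue — the M-convexity clause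
  in the tree's Definition-2.6 reading of `L²_n` is redundant ("a quadratic form with nonnegative coefficients is Lorentzian
  if and only if it is stable", Lemma 2.5, with stable ⟺ `sigPos ≤ 1` for such forms).
* §4 **`mem_lorentzian_iff_forall_sigPos_hessian`** — THEOREM 2.25 in its printed form for Definition 2.6: `f ∈ L^d_n` iff
  `f ∈ M^d_n` (homogeneous, nonnegative coefficients, M-convex support) and `𝓗_{∂^α f}` has at most one positive eigenvalue
  for every `α ∈ Δ^{d-2}_n`; and `mem_lorentzian_iff_forall_sigPos_normCoeff` (the same with `𝓗_{∂^α f} = (c_{α+e_i+e_j})_{ij}`),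
  which upgrades `Basic`'s full-support criterion `mem_lorentzian_of_forall_coeff_pos` to an equivalence.

Theorems only; no definition, no `sorry`, no named fact (net debt 0). The equivalence of Definition 2.6 with Definition
2.1 (limits of strictly Lorentzian polynomials) is still NOT claimed.

## References

* [BrandenHuh2019] P. Brändén, J. Huh, *Lorentzian polynomials*, Ann. of Math. (2) 192 (2020) 821–891, arXiv:1902.03719 —
  §2.1 Lemma 2.5; §2.2 (p. 11), Def. 2.6; §2.4 Thm. 2.25.
* [ShenfeldVanHandel2019] Y. Shenfeld, R. van Handel, *Mixed volumes and the Bochner method*, Proc. AMS 147 (2019), Lemma 2.9.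
-/

noncomputable section

open MvPolynomial Finsupp Finset
open scoped Nat

namespace Literature.Combinatorics.LorentzianPolynomials

variable {σ : Type*}

/-! ## §1 Degree-`2` exponents and the Hessian of a quadratic form with nonnegative coefficients -/

section DegreeTwo

/-- `Δ²_n = {e_i + e_m}`: an exponent of degree `2` is a sum of two unit vectors (possibly equal).
[cite: BrandenHuh2019, §2.1 (p. 8, `Δ^d_n`; the Hessian `(∂_i ∂_j f)`)] -/
theorem exists_eq_single_add_single_of_degree_eq_two {α : σ →₀ ℕ} (hα : α.degree = 2) :
    ∃ i m, α = Finsupp.single i 1 + Finsupp.single m 1 := by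
  have hne : α ≠ 0 := by rintro rfl; simp at hα
  obtain ⟨i, hi⟩ := Finsupp.ne_iff.1 hne
  rw [Finsupp.coe_zero, Pi.zero_apply] at hi
  have h1 : (α - Finsupp.single i 1).degree = 1 := by have := degree_sub_single_add_one hi; omega
  have hne' : α - Finsupp.single i 1 ≠ 0 := by intro h; rw [h] at h1; simp at h1
  obtain ⟨m, hm⟩ := Finsupp.ne_iff.1 hne'
  rw [Finsupp.coe_zero, Pi.zero_apply] at hm
  exact ⟨i, m, by rw [← eq_single_of_degree_eq_one h1 hm, add_comm, Finsupp.sub_add_single_one_cancel hi]⟩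

/-- If `α_i ≠ 0` and `|α| = 2` then `α = e_m + e_i` with `e_m = α - e_i`. [cite: BrandenHuh2019, §2.1 (p. 8)] -/
theorem exists_eq_single_add_single_of_apply_ne_zero {α : σ →₀ ℕ} (hα : α.degree = 2) {i : σ} (hi : α i ≠ 0) :
    ∃ m, α - Finsupp.single i 1 = Finsupp.single m 1 ∧ α = Finsupp.single m 1 + Finsupp.single i 1 := by
  have h1 : (α - Finsupp.single i 1).degree = 1 := by have := degree_sub_single_add_one hi; omega
  have hne' : α - Finsupp.single i 1 ≠ 0 := by intro h; rw [h] at h1; simp at h1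
  obtain ⟨m, hm⟩ := Finsupp.ne_iff.1 hne'
  rw [Finsupp.coe_zero, Pi.zero_apply] at hm
  have h := eq_single_of_degree_eq_one h1 hm
  exact ⟨m, h, by rw [← h, Finsupp.sub_add_single_one_cancel hi]⟩

variable [Fintype σ]

/-- The Hessian of a quadratic form with nonnegative coefficients has nonnegative entries (`𝓗_{ij} = c_{e_i+e_j}`).
[cite: BrandenHuh2019, §2.1 proof of Lemma 2.5 ("all the entries of `𝓗_f` are positive" on `P²_n`)] -/
theorem hessian_nonneg {q : MvPolynomial σ ℝ} (hnn : ∀ α, 0 ≤ coeff α q) (i j : σ) : 0 ≤ hessian q i j := by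
  rw [hessian_apply_eq_normCoeff]
  exact normCoeff_nonneg_iff.2 (hnn _)

/-- `𝓗_{ij} > 0 ⟺ e_i + e_j ∈ supp q` for nonnegative coefficients. [cite: BrandenHuh2019, §2.1 (p. 8, `𝓗_f`); §2.2 (p. 11,
`supp(f)`)] -/
theorem hessian_pos_iff {q : MvPolynomial σ ℝ} (hnn : ∀ α, 0 ≤ coeff α q) {i j : σ} :
    0 < hessian q i j ↔ coeff (Finsupp.single i 1 + Finsupp.single j 1) q ≠ 0 := by
  rw [hessian_apply_eq_normCoeff, ne_eq, ← normCoeff_eq_zero_iff]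
  have h0 := normCoeff_nonneg_iff.2 (hnn (Finsupp.single i 1 + Finsupp.single j 1))
  exact ⟨fun h ↦ h.ne', fun h ↦ lt_of_le_of_ne h0 (Ne.symm h)⟩

variable [DecidableEq σ]

/-- `e_iᵀ M e_j = M_{ij}`. [folklore] -/
private theorem toBilin'_single_single' (M : Matrix σ σ ℝ) (i j : σ) :
    Matrix.toBilin' M (Pi.single i 1) (Pi.single j 1) = M i j := by
  rw [Matrix.toBilin'_apply']
  simp

/-- `(v, w) ↦ vᵀ M w` is symmetric for symmetric `M`. [folklore] -/
private theorem isSymm_toBilin'_of_isSymm' {M : Matrix σ σ ℝ} (hM : M.IsSymm) : LinearMap.IsSymm (Matrix.toBilin' M) :=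
  ⟨fun v w ↦ by
    rw [Matrix.toBilin'_apply', Matrix.toBilin'_apply', Matrix.dotProduct_mulVec, ← Matrix.mulVec_transpose, hM.eq,
      dotProduct_comm, RingHom.id_apply]⟩

end DegreeTwo

/-! ## §2 The engine: `𝓗_{im} > 0`, `yᵀ 𝓗 y > 0 ⟹ (𝓗 y)_m ≠ 0` (reverse Cauchy–Schwarz at `e_m + t e_i`, `t → 0⁺`) -/

section Engine

variable [Fintype σ] [DecidableEq σ]

/-- **The engine.** Let `q` be a quadratic form with nonnegative coefficients whose Hessian `𝓗` has at most one positive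
eigenvalue. If `𝓗_{im} > 0` and `yᵀ 𝓗 y > 0`, then `e_mᵀ 𝓗 y ≠ 0`: otherwise the reverse Cauchy–Schwarz inequality
`(xᵀ𝓗y)² ≥ (xᵀ𝓗x)(yᵀ𝓗y)` (Shenfeld–van Handel Lemma 2.9, tree `mul_le_sq_of_sigPos_le_one`; Brändén–Huh Lemma 2.5 (2))
at `x = e_m + t e_i` would give `t² (e_iᵀ𝓗y)² ≥ (𝓗_{mm} + 2t 𝓗_{im} + t² 𝓗_{ii}) yᵀ𝓗y ≥ 2t 𝓗_{im} yᵀ𝓗y`, false for small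
`t > 0`. [cite: BrandenHuh2019, §2.1 Lemma 2.5 ((1) ⇒ (2))] [cite: ShenfeldVanHandel2019, Lemma 2.9] -/
theorem toBilin'_hessian_single_ne_zero {q : MvPolynomial σ ℝ} (hnn : ∀ α, 0 ≤ coeff α q)
    (hsig : sigPos (Matrix.toBilin' (hessian q)).toQuadraticMap ≤ 1) {i m : σ} (him : 0 < hessian q i m)
    {y : σ → ℝ} (hy : 0 < Matrix.toBilin' (hessian q) y y) :
    Matrix.toBilin' (hessian q) (Pi.single m 1) y ≠ 0 := by
  set B := Matrix.toBilin' (hessian q) with hB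
  have hBs : LinearMap.IsSymm B := isSymm_toBilin'_of_isSymm' (isSymm_hessian q)
  intro h0
  set S : ℝ := B (Pi.single i 1) y with hS
  set P : ℝ := hessian q i m * B y y with hP
  have hPpos : 0 < P := mul_pos him hy
  set t : ℝ := P / (S ^ 2 + 1) with ht
  have hS2 : 0 < S ^ 2 + 1 := by positivity
  have htpos : 0 < t := div_pos hPpos hS2
  have key := Literature.LinearAlgebra.QuadraticForm.mul_le_sq_of_sigPos_le_one B hBs hsig
    (Pi.single m 1 + t • Pi.single i 1) y hy.le
  have hxy : B (Pi.single m 1 + t • Pi.single i 1) y = t * S := by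
    rw [map_add, LinearMap.add_apply, map_smul, LinearMap.smul_apply, h0, zero_add, smul_eq_mul]
  have hxx : B (Pi.single m 1 + t • Pi.single i 1) (Pi.single m 1 + t • Pi.single i 1) =
      hessian q m m + t * hessian q i m + t * hessian q i m + t ^ 2 * hessian q i i := by
    simp only [map_add, map_smul, LinearMap.add_apply, LinearMap.smul_apply, smul_eq_mul, hB,
      toBilin'_single_single', hessian_comm q m i]
    ring
  have hmm := hessian_nonneg hnn m m
  have hii := hessian_nonneg hnn i i
  have hlow : 2 * t * hessian q i m ≤ B (Pi.single m 1 + t • Pi.single i 1) (Pi.single m 1 + t • Pi.single i 1) := by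
    rw [hxx]
    nlinarith [sq_nonneg t, mul_nonneg (sq_nonneg t) hii]
  rw [hxy] at key
  -- `2 t P ≤ (t S)²`, i.e. `2 P ≤ t S²`, but `t S² < P`
  have h1 : 2 * t * P ≤ t * (t * S ^ 2) := by
    have h := mul_le_mul_of_nonneg_right hlow hy.le
    have e : (t * S) ^ 2 = t * (t * S ^ 2) := by ring
    rw [hP]
    nlinarith [h, key, e]
  have h2 : 2 * P ≤ t * S ^ 2 := le_of_mul_le_mul_left (by linarith [h1]) htpos
  have h3 : t * S ^ 2 < P := by
    rw [ht, div_mul_eq_mul_div, div_lt_iff₀ hS2]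
    nlinarith [hPpos]
  linarith

/-- **Exchange partners exist**: if `𝓗_{im} > 0` for some `i` and `𝓗_{kl} > 0`, then `𝓗_{mk} > 0` or `𝓗_{ml} > 0` (the engine at
`y = e_k + e_l`, for which `yᵀ𝓗y ≥ 2𝓗_{kl} > 0` and `e_mᵀ𝓗y = 𝓗_{mk} + 𝓗_{ml}`). [cite: BrandenHuh2019, §2.1 Lemma 2.5; §2.4
Thm. 2.25 ("the support of `f` is M-convex")] -/
theorem hessian_pos_or_pos {q : MvPolynomial σ ℝ} (hnn : ∀ α, 0 ≤ coeff α q)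
    (hsig : sigPos (Matrix.toBilin' (hessian q)).toQuadraticMap ≤ 1) {i m k l : σ} (him : 0 < hessian q i m)
    (hkl : 0 < hessian q k l) : 0 < hessian q m k ∨ 0 < hessian q m l := by
  have hy : 0 < Matrix.toBilin' (hessian q) (Pi.single k 1 + Pi.single l 1) (Pi.single k 1 + Pi.single l 1) := by
    simp only [map_add, LinearMap.add_apply, toBilin'_single_single', hessian_comm q l k]
    have := hessian_nonneg hnn k k
    have := hessian_nonneg hnn l l
    linarith
  have h := toBilin'_hessian_single_ne_zero hnn hsig him hy
  rw [map_add, toBilin'_single_single', toBilin'_single_single'] at h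
  have hmk := hessian_nonneg hnn m k
  have hml := hessian_nonneg hnn m l
  by_contra hne
  push Not at hne
  exact h (by linarith [le_antisymm hne.1 hmk, le_antisymm hne.2 hml])

end Engine

/-! ## §3 The support of a quadratic form with at most one positive eigenvalue is M-convex -/

section Support

variable [Fintype σ] [DecidableEq σ]

/-- **A quadratic form with nonnegative coefficients whose Hessian has at most one positive eigenvalue has M-convex
support** (Lemma 2.5 with Theorem 2.25 at `d = 2`: for such forms "Lorentzian", "stable" and "at most one positive
eigenvalue" agree, and Lorentzian polynomials have M-convex support). Direct proof of the exchange property: for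
`α = e_i + e_m`, `β = e_k + e_l ∈ supp q` with `α_i > β_i`, the partner `j ∈ {k, l}` is read off `β` when `m ∈ {k, l}`,
and is supplied by the engine (`𝓗_{mk} > 0` or `𝓗_{ml} > 0`) otherwise. [cite: BrandenHuh2019, §2.1 Lemma 2.5 ("a quadratic
form with nonnegative coefficients is Lorentzian if and only if it is stable"); §2.4 Thm. 2.25] -/
theorem isMConvex_support_of_sigPos_le_one {q : MvPolynomial σ ℝ} (hq : q.IsHomogeneous 2) (hnn : ∀ α, 0 ≤ coeff α q)
    (hsig : sigPos (Matrix.toBilin' (hessian q)).toQuadraticMap ≤ 1) :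
    IsMConvex {α : σ →₀ ℕ | coeff α q ≠ 0} := by
  intro α β hα hβ i hi
  rw [Set.mem_setOf_eq] at hα hβ
  have hαd : α.degree = 2 := by by_contra h; exact hα (hq.coeff_eq_zero h)
  have hβd : β.degree = 2 := by by_contra h; exact hβ (hq.coeff_eq_zero h)
  have hαi : α i ≠ 0 := by omega
  -- `α = e_m + e_i`, `β = e_k + e_l`
  obtain ⟨m, hmα, hαeq⟩ := exists_eq_single_add_single_of_apply_ne_zero hαd hαi
  obtain ⟨k, l, hβeq⟩ := exists_eq_single_add_single_of_degree_eq_two hβd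
  have hH : ∀ {a b : σ}, coeff (Finsupp.single a 1 + Finsupp.single b 1) q ≠ 0 ↔ 0 < hessian q a b :=
    fun {a b} ↦ (hessian_pos_iff hnn).symm
  have him : 0 < hessian q i m := by rw [hessian_comm, ← hH, ← hαeq]; exact hα
  have hkl : 0 < hessian q k l := by rw [← hH, ← hβeq]; exact hβ
  have hαj : ∀ j, α j = (if m = j then 1 else 0) + (if i = j then 1 else 0) := fun j ↦ by
    conv_lhs => rw [hαeq]
    rw [Finsupp.add_apply, Finsupp.single_apply, Finsupp.single_apply]
  have hβj : ∀ j, β j = (if k = j then 1 else 0) + (if l = j then 1 else 0) := fun j ↦ by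
    conv_lhs => rw [hβeq]
    rw [Finsupp.add_apply, Finsupp.single_apply, Finsupp.single_apply]
  have hi' : ((if k = i then 1 else 0) + if l = i then 1 else 0) < (if m = i then 1 else 0) + 1 := by
    have h := hi
    rw [hαj i, hβj i, if_pos (rfl : i = i)] at h
    exact h
  have hβi0 : m ≠ i → β i = 0 := fun hmi ↦ by
    have h := hi
    rw [hαj i, if_neg hmi, if_pos (rfl : i = i)] at h
    omega
  -- the exchange `α - e_i + e_j = e_m + e_j`; it lies in the support iff `𝓗_{mj} > 0`
  simp only [Set.mem_setOf_eq, hmα]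
  -- Case 1: `m ∈ {k, l}` — the partner is the other letter of `β`
  by_cases hmk : m = k
  · by_cases hml : m = l
    · -- `β = 2 e_m`: partner `m` (and `i ≠ m`, else `α = β`)
      have hmi : m ≠ i := fun hmi ↦ by
        rw [← hmk, ← hml, hmi, if_pos (rfl : i = i)] at hi'
        omega
      refine ⟨m, ?_, ?_⟩
      · rw [hαj, hβj, ← hmk, ← hml, if_pos (rfl : m = m), if_neg (fun h : i = m ↦ hmi h.symm)]
        omega
      · rw [← hmk, ← hml] at hβeq
        rw [← hβeq]; exact hβ
    · -- `β = e_m + e_l`, `l ≠ m`: partner `l`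
      have hil : i ≠ l := fun hil ↦ by
        rw [← hmk, ← hil, if_pos (rfl : i = i)] at hi'
        split_ifs at hi' <;> omega
      have hkl' : k ≠ l := fun h ↦ hml (hmk.trans h)
      refine ⟨l, ?_, ?_⟩
      · rw [hαj, hβj, if_neg hml, if_neg hil, if_neg hkl', if_pos (rfl : l = l)]
        omega
      · rw [← hmk] at hβeq
        rw [← hβeq]; exact hβ
  by_cases hml : m = l
  · -- `β = e_k + e_m`, `k ≠ m`: partner `k`
    have hik : i ≠ k := fun hik ↦ by
      rw [← hml, ← hik, if_pos (rfl : i = i)] at hi'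
      split_ifs at hi' <;> omega
    have hlk' : l ≠ k := fun h ↦ hmk (hml.trans h)
    refine ⟨k, ?_, ?_⟩
    · rw [hαj, hβj, if_neg hmk, if_neg hik, if_neg hlk', if_pos (rfl : k = k)]
      omega
    · rw [← hml] at hβeq
      rw [add_comm, ← hβeq]; exact hβ
  -- Case 2: `m ∉ {k, l}` — then `i ∉ {k, l}`, and the engine supplies the partner
  have hik : i ≠ k := fun hik ↦ by
    by_cases hmi : m = i
    · exact hmk (hmi.trans hik)
    · have h0 := hβi0 hmi
      rw [hβj, ← hik, if_pos (rfl : i = i)] at h0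
      omega
  have hil : i ≠ l := fun hil ↦ by
    by_cases hmi : m = i
    · exact hml (hmi.trans hil)
    · have h0 := hβi0 hmi
      rw [hβj, ← hil, if_pos (rfl : i = i)] at h0
      omega
  rcases hessian_pos_or_pos hnn hsig him hkl with hmk' | hml'
  · refine ⟨k, ?_, hH.2 hmk'⟩
    rw [hαj, hβj, if_neg hmk, if_neg hik, if_pos (rfl : k = k)]
    omega
  · refine ⟨l, ?_, hH.2 hml'⟩
    rw [hαj, hβj, if_neg hml, if_neg hil, if_pos (rfl : l = l)]
    omega

/-- **`L²_n` = quadratic forms with nonnegative coefficients and at most one positive eigenvalue**: in the tree's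
Definition-2.6 reading of `L²_n` (`mem_lorentzian_two`: nonnegative coefficients, M-convex support, `sigPos 𝓗 ≤ 1`) the
M-convexity clause is redundant. Brändén–Huh: "a quadratic form with nonnegative coefficients is Lorentzian if and only if
it is stable" (and has at most one positive eigenvalue, Lemma 2.5 / Thm. 2.25). [cite: BrandenHuh2019, §2.1 Lemma 2.5; §2.4
Thm. 2.25 (`d = 2`)] -/
theorem mem_lorentzian_two_iff_sigPos {q : MvPolynomial σ ℝ} :
    q ∈ lorentzian σ 2 ↔
      q.IsHomogeneous 2 ∧ (∀ α, 0 ≤ coeff α q) ∧ sigPos (Matrix.toBilin' (hessian q)).toQuadraticMap ≤ 1 := by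
  rw [mem_lorentzian_two]
  exact ⟨fun ⟨h1, h2, _, h4⟩ ↦ ⟨h1, h2, h4⟩, fun ⟨h1, h2, h4⟩ ↦ ⟨h1, h2, isMConvex_support_of_sigPos_le_one h1 h2 h4, h4⟩⟩

end Support

/-! ## §4 Theorem 2.25 as printed (for Definition 2.6) -/

section Criterion

variable [Fintype σ] [DecidableEq σ]

/-- **Brändén–Huh, Theorem 2.25 (criterion form, for `L^d_n` of Definition 2.6).** "a degree `d` homogeneous polynomial `f`
with nonnegative coefficients is Lorentzian if and only if the support of `f` is M-convex and `∂^α f` has at most one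
positive eigenvalue for every `α ∈ Δ^{d-2}_n`" — here `d = m + 2`, "at most one positive eigenvalue" = `sigPos 𝓗_{∂^α f} ≤ 1`.
(The second form of Def. 2.6 asks `∂^α f ∈ L²_n`; by §3 the M-convexity of `supp ∂^α f` comes for free.)
[cite: BrandenHuh2019, §2.4 Thm. 2.25; §2.2 Def. 2.6] -/
theorem mem_lorentzian_iff_forall_sigPos_hessian {m : ℕ} {f : MvPolynomial σ ℝ} :
    f ∈ lorentzian σ (m + 2) ↔
      (f.IsHomogeneous (m + 2) ∧ (∀ α, 0 ≤ coeff α f) ∧ IsMConvex {α | coeff α f ≠ 0}) ∧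
        ∀ α : σ →₀ ℕ, α.degree = m → sigPos (Matrix.toBilin' (hessian (iterPderiv α f))).toQuadraticMap ≤ 1 := by
  rw [mem_lorentzian_iff_forall_iterPderiv]
  constructor
  · rintro ⟨hM, h⟩
    exact ⟨hM, fun α hα ↦ (mem_lorentzian_two_iff_sigPos.1 (h α hα)).2.2⟩
  · rintro ⟨⟨hhom, hnn, hMc⟩, h⟩
    refine ⟨⟨hhom, hnn, hMc⟩, fun α hα ↦ mem_lorentzian_two_iff_sigPos.2 ⟨?_, coeff_iterPderiv_nonneg hnn α, h α hα⟩⟩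
    exact IsHomogeneous.iterPderiv α (by rw [hα, add_comm]; exact hhom)

/-- **Theorem 2.25 with the Hessians written out**: `f ∈ L^{m+2}_n` iff `f ∈ M^{m+2}_n` and, for every `α ∈ Δ^m_n`, the matrix
`(c_{α+e_i+e_j}(f))_{i,j} = 𝓗_{∂^α f}` has at most one positive eigenvalue. Upgrades `Basic`'s full-support criterion
`mem_lorentzian_of_forall_coeff_pos` to an equivalence. [cite: BrandenHuh2019, §2.4 Thm. 2.25; §4.1 Prop. 4.5
("`v_i^T 𝓗 v_j = D_i D_j D_3 ⋯ D_d f`")] -/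
theorem mem_lorentzian_iff_forall_sigPos_normCoeff {m : ℕ} {f : MvPolynomial σ ℝ} :
    f ∈ lorentzian σ (m + 2) ↔
      (f.IsHomogeneous (m + 2) ∧ (∀ α, 0 ≤ coeff α f) ∧ IsMConvex {α | coeff α f ≠ 0}) ∧
        ∀ α : σ →₀ ℕ, α.degree = m → sigPos (Matrix.toBilin'
          (Matrix.of fun i j ↦ normCoeff (α + Finsupp.single i 1 + Finsupp.single j 1) f)).toQuadraticMap ≤ 1 := by
  rw [mem_lorentzian_iff_forall_sigPos_hessian]
  refine and_congr_right fun _ ↦ forall₂_congr fun α _ ↦ ?_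
  rw [hessian_iterPderiv_eq]

end Criterion

end Literature.Combinatorics.LorentzianPolynomials

end
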